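import Summits.ResolutionOfSingularities.ResolutionOfSingularities.Theorems.FrobeniusClosingPatchingRelPerfectTangentEuclidCharts
import HarnessLib

/-!
# Crux `PatchingRelPerfect` (stmt-ResolutionOfSingularities-16161), chain w52 — rung tool
# TANGENT EUCLID, part 3: the EXPLICIT tower for `K = (t + c²) + (t²)` (companion avatars named)

[OURS · L1 W5.2 · rung tool, kernel (iii) support] Part 2 (`…TangentEuclid.lean`, p505269) produces
the companion of `(η t + cᵏ) + (t^β)` EXISTENTIALLY (a list of exponent pairs from stub-1's
`euclid_exponents`).  A kernel certificate of a MEMBER needs the avatars by name, because one global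
companion of `S` must serve every chart: for the simplest non-graded member `(x₃² + x₀³) + 𝔪⁴` (this
seat's note `NONGRADED-CUSP-MEMBER.md`, evidence #52) both first-stage branches end in the shape
`k = β = 2`, `η = 1`, whose Euclid `(1, kβ - 1) = (1, 3)` is the three-step regular-centre tower with
factors `(h′) + (c)`, `(h′) + (c²)`, `(h′) + (c³)` — the images of the base avatars
`(t + c²) + (c²)`, `(t + c²) + (c³)` and of `K` itself.  PROVED, every regular ring, no dimension /
characteristic / residue-field hypothesis:

* `CoreRungTower.tangent_euclid_two_two` — for `(t, c)` quasi-regular with `R/(t, c)` regular, every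
  blowing up of `Spec R` along `((t + c²) + (t²)) · ((t + c²) + (c²)) · ((t + c²) + (c³)) · (t, c)` is
  regular (part 1's chart images + stub-1's `isRegular_of_isBlowup_tower 3` on the `c`-chart after the
  re-lettering `(c, τ + c)`; everything Cartier on the `t`-chart).

FORMAT evidence / a tool for kernel-(iii) certificates (CHAIN §1 (A), (C)); nothing here is a
statement of the manuscript under review.

## References

* Q. Liu, *Algebraic Geometry and Arithmetic Curves*, OUP 2002, Thm. 8.1.19 (a). [Liu2002]
* The Stacks Project, Tags 080A, 080B, 0804, 0BIQ. [StacksProject]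
-/

-- `Summit.<Summit>.<Sub>.Theorems` with `Sub = Summit` (single-conjunct summit, D-0017)
set_option linter.dupNamespace false

noncomputable section

open CategoryTheory CategoryTheory.Limits AlgebraicGeometry Literature.AlgebraicGeometry.Resolution

namespace Summit.ResolutionOfSingularities.ResolutionOfSingularities.Theorems

universe u

namespace CoreRungTower

/-- The three-step tower product, unfolded: `∏_{k<3} (P + Mᵏ⁺¹) = (P + (g)) (P + (g²)) (P + (g³))`
for `M = P + (g)`. [folklore] -/
theorem prod_range_three_sup_pow {A : Type*} [CommSemiring A] {P M : Ideal A} {g : A}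
    (hM : M = P ⊔ Ideal.span {g}) :
    ∏ k ∈ Finset.range 3, (P ⊔ M ^ (k + 1)) =
      (P ⊔ Ideal.span {g ^ 1}) * (P ⊔ Ideal.span {g ^ 2}) * (P ⊔ Ideal.span {g ^ 3}) := by
  simp only [Finset.prod_range_succ, Finset.prod_range_zero, one_mul,
    sup_pow_eq_sup_span_singleton_pow hM, zero_add, Nat.reduceAdd]

set_option maxHeartbeats 400000 in
/-- **TANGENT EUCLID, EXPLICIT (`k = β = 2`, `η = 1`).** For `(t, c)` quasi-regular with `R/(t, c)` a
regular ring in a regular ring `R`, every blowing up of `Spec R` along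
`((t + c²) + (t²)) · ((t + c²) + (c²)) · ((t + c²) + (c³)) · (t, c)` is a regular scheme: blow up the
tangency locus `V(t, c)`; on the `t`-chart everything is the Cartier divisor `(t³)`; on the `c`-chart,
with `h′ = τ + c` (`t = cτ`), the residual is `c³ · ((h′) + (c³)) ((h′) + (c)) ((h′) + (c²))`, the
three-step tower of regular centres `V(h′) ∩ V(c)` (stub-1's `isRegular_of_isBlowup_tower`).
[cite: Liu2002, Thm. 8.1.19 (a)] [cite: StacksProject, Tag 080A] [cite: StacksProject, Tag 080B] -/
theorem tangent_euclid_two_two {R : Type u} [CommRing R] [IsRegularRing R] (t c : R)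
    (hx : IsQuasiRegular (![t, c] : Fin 2 → R))
    (hR : IsRegularRing (R ⧸ Ideal.span (Set.range (![t, c] : Fin 2 → R))))
    {Y : Scheme.{u}} {f : Y ⟶ Spec (.of R)}
    (hf : IsBlowup f (affineBlowup.idealSheaf
      (((Ideal.span {t + c ^ 2} ⊔ Ideal.span {t ^ 2}) *
        ((Ideal.span {t + c ^ 2} ⊔ Ideal.span {c ^ 2}) * (Ideal.span {t + c ^ 2} ⊔ Ideal.span {c ^ 3}))) *
        Ideal.span (Set.range (![t, c] : Fin 2 → R))))) :
    Scheme.IsRegular Y := by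
  haveI := hR
  -- the part-1 chart images, specialised to `η = 1`, `k = β = 2`, and normalised
  have hK₁ : (Ideal.span {t + c ^ 2} ⊔ Ideal.span {t ^ 2}).map (chartBase (![t, c] : Fin 2 → R) 1) =
      Ideal.span {chartBase (![t, c] : Fin 2 → R) 1 c} *
        (Ideal.span {chartBase (![t, c] : Fin 2 → R) 1 1 * chartGen (![t, c] : Fin 2 → R) 1 0 +
          chartBase (![t, c] : Fin 2 → R) 1 c ^ 1} ⊔
          Ideal.span {chartBase (![t, c] : Fin 2 → R) 1 c ^ 3}) := by
    have h := map_chartBase_one_tangent t c 1 isUnit_one 1 1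
    have e1 : (1 : R) * t + c ^ (1 + 1) = t + c ^ 2 := by ring
    have e2 : t ^ (1 + 1) = t ^ 2 := by ring
    have e4 : ((1 + 1) * 1 + 1 : ℕ) = 3 := by norm_num
    rw [e1, e2, e4] at h
    exact h
  have hF₁ : ∀ j : ℕ, (Ideal.span {t + c ^ 2} ⊔ Ideal.span {c ^ (1 + j)}).map (chartBase (![t, c] : Fin 2 → R) 1) =
      Ideal.span {chartBase (![t, c] : Fin 2 → R) 1 c ^ 1} *
        (Ideal.span {chartBase (![t, c] : Fin 2 → R) 1 1 * chartGen (![t, c] : Fin 2 → R) 1 0 +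
          chartBase (![t, c] : Fin 2 → R) 1 c ^ 1} ⊔
          Ideal.span {chartBase (![t, c] : Fin 2 → R) 1 c ^ j}) := by
    intro j
    have h := map_chartBase_one_tangentFactor t c 1 1 1 j
    have e1 : (1 : R) * t + c ^ (1 + 1) = t + c ^ 2 := by ring
    rw [e1, pow_one (Ideal.span {t + c ^ 2}),
      pow_one (Ideal.span {chartBase (![t, c] : Fin 2 → R) 1 1 * chartGen (![t, c] : Fin 2 → R) 1 0 +
          chartBase (![t, c] : Fin 2 → R) 1 c ^ 1})] at h
    exact h
  have hK₀ : (Ideal.span {t + c ^ 2} ⊔ Ideal.span {t ^ 2}).map (chartBase (![t, c] : Fin 2 → R) 0) =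
      Ideal.span {chartBase (![t, c] : Fin 2 → R) 0 t} := by
    have h := map_chartBase_zero_tangent t c 1 isUnit_one 0 1
    have e1 : (1 : R) * t + c ^ (0 + 1 + 1) = t + c ^ 2 := by ring
    have e2 : t ^ (1 + 1) = t ^ 2 := by ring
    rw [e1, e2] at h
    exact h
  have hF₀ : ∀ j : ℕ, (Ideal.span {t + c ^ 2} ⊔ Ideal.span {c ^ (1 + j)}).map (chartBase (![t, c] : Fin 2 → R) 0) =
      Ideal.span {chartBase (![t, c] : Fin 2 → R) 0 t ^ 1} := by
    intro j
    have h := map_chartBase_zero_tangentFactor t c 1 isUnit_one 0 1 j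
    have e1 : (1 : R) * t + c ^ (0 + 1 + 1) = t + c ^ 2 := by ring
    rw [e1, pow_one (Ideal.span {t + c ^ 2})] at h
    exact h
  have hc2 : Ideal.span {t + c ^ 2} ⊔ Ideal.span {c ^ 2} = Ideal.span {t + c ^ 2} ⊔ Ideal.span {c ^ (1 + 1)} := by
    norm_num
  have hc3 : Ideal.span {t + c ^ 2} ⊔ Ideal.span {c ^ 3} = Ideal.span {t + c ^ 2} ⊔ Ideal.span {c ^ (1 + 2)} := by
    norm_num
  rw [hc2, hc3] at hf
  refine isRegular_of_isBlowup_mul_of_charts (![t, c] : Fin 2 → R) _ (fun i => ?_) hf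
  have hi : i = 0 ∨ i = 1 := by
    fin_cases i
    · exact Or.inl rfl
    · exact Or.inr rfl
  rcases hi with rfl | rfl
  · -- the `t`-chart: everything is the Cartier divisor `(t³)`
    intro Y' ρ hρ
    haveI hB : IsRegularRing (chartRing (![t, c] : Fin 2 → R) 0) := isRegularRing_blowupChart _ 0 hx
    have hti : chartBase (![t, c] : Fin 2 → R) 0 t ∈ nonZeroDivisors (chartRing (![t, c] : Fin 2 → R) 0) :=
      reesChartBase_mem_nonZeroDivisors ((![t, c] : Fin 2 → R) 0)
        (Ideal.mem_span_range_self (f := (![t, c] : Fin 2 → R)) (x := 0))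
    rw [Ideal.map_mul, Ideal.map_mul, hK₀, hF₀, hF₀, Ideal.span_singleton_mul_span_singleton,
      Ideal.span_singleton_mul_span_singleton] at hρ
    have hρ2 : IsBlowup ρ (affineBlowup.idealSheaf (Ideal.span {chartBase (![t, c] : Fin 2 → R) 0 t *
        (chartBase (![t, c] : Fin 2 → R) 0 t ^ 1 * chartBase (![t, c] : Fin 2 → R) 0 t ^ 1)} * ⊤)) := by
      rwa [Ideal.mul_top]
    refine CoreRungTower.isRegular_of_isBlowup_span_singleton_mul
      (mul_mem hti (mul_mem (pow_mem hti 1) (pow_mem hti 1))) _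
      (fun Y'' ρ' hρ' => ?_) hρ2
    rw [affineBlowup.idealSheaf_top] at hρ'
    haveI : IsIso ρ' := hρ'.isIso isEffectiveCartier_top
    haveI : IsRegularRing (CommRingCat.of (chartRing (![t, c] : Fin 2 → R) 0)) := hB
    exact SectionAscent.TraceIdeal.isRegular_of_iso (asIso ρ') (Scheme.isRegular_Spec _)
  · -- the `c`-chart: re-letter `(c, h′)`, `h′ = τ + c`, and run the three-step tower
    intro Y' ρ hρ
    haveI hB : IsRegularRing (chartRing (![t, c] : Fin 2 → R) 1) := isRegularRing_blowupChart _ 1 hx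
    have hci : chartBase (![t, c] : Fin 2 → R) 1 c ∈ nonZeroDivisors (chartRing (![t, c] : Fin 2 → R) 1) :=
      reesChartBase_mem_nonZeroDivisors ((![t, c] : Fin 2 → R) 1)
        (Ideal.mem_span_range_self (f := (![t, c] : Fin 2 → R)) (x := 1))
    rw [Ideal.map_mul, Ideal.map_mul, hK₁, hF₁, hF₁] at hρ
    -- collect the Cartier twist `c³`
    have key : ∀ (A B C : Ideal (chartRing (![t, c] : Fin 2 → R) 1)) (g : chartRing (![t, c] : Fin 2 → R) 1),
        Ideal.span {g} * A * (Ideal.span {g ^ 1} * B * (Ideal.span {g ^ 1} * C)) =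
          Ideal.span {g * (g ^ 1 * g ^ 1)} * (B * C * A) := by
      intro A B C g
      rw [← Ideal.span_singleton_mul_span_singleton, ← Ideal.span_singleton_mul_span_singleton]
      ring
    rw [key] at hρ
    refine CoreRungTower.isRegular_of_isBlowup_span_singleton_mul
      (mul_mem hci (mul_mem (pow_mem hci 1) (pow_mem hci 1))) _
      (fun Y'' ρ' hρ' => ?_) hρ
    -- the tower for `x' = (c, h′)`, `P' = (h′)`
    have hx' : IsQuasiRegular (Fin.cons (chartBase (![t, c] : Fin 2 → R) 1 c)
        (fun _ : Fin 1 => chartBase (![t, c] : Fin 2 → R) 1 1 * chartGen (![t, c] : Fin 2 → R) 1 0 +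
          chartBase (![t, c] : Fin 2 → R) 1 c ^ 1) :
        Fin 2 → chartRing (![t, c] : Fin 2 → R) 1) := by
      have h := isWeaklyRegular_exc_strict t c 1 isUnit_one hx 0
      rw [Nat.zero_add] at h
      exact isQuasiRegular_of_isWeaklyRegular _ h
    have hR' : IsRegularRing (chartRing (![t, c] : Fin 2 → R) 1 ⧸ Ideal.span (Set.range
        (Fin.cons (chartBase (![t, c] : Fin 2 → R) 1 c)
          (fun _ : Fin 1 => chartBase (![t, c] : Fin 2 → R) 1 1 * chartGen (![t, c] : Fin 2 → R) 1 0 +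
          chartBase (![t, c] : Fin 2 → R) 1 c ^ 1) :
          Fin 2 → chartRing (![t, c] : Fin 2 → R) 1))) := by
      have h := isRegularRing_quot_exc_strict t c 1 isUnit_one hx 0
      rw [Nat.zero_add] at h
      exact h
    have hP : Ideal.span (Set.range ((Fin.cons (chartBase (![t, c] : Fin 2 → R) 1 c)
        (fun _ : Fin 1 => chartBase (![t, c] : Fin 2 → R) 1 1 * chartGen (![t, c] : Fin 2 → R) 1 0 +
          chartBase (![t, c] : Fin 2 → R) 1 c ^ 1) :
          Fin 2 → chartRing (![t, c] : Fin 2 → R) 1) ∘ (fun _ : Fin 1 => (1 : Fin 2)))) =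
        Ideal.span {chartBase (![t, c] : Fin 2 → R) 1 1 * chartGen (![t, c] : Fin 2 → R) 1 0 +
          chartBase (![t, c] : Fin 2 → R) 1 c ^ 1} := by
      have hr : Set.range ((Fin.cons (chartBase (![t, c] : Fin 2 → R) 1 c)
          (fun _ : Fin 1 => chartBase (![t, c] : Fin 2 → R) 1 1 * chartGen (![t, c] : Fin 2 → R) 1 0 +
          chartBase (![t, c] : Fin 2 → R) 1 c ^ 1) :
            Fin 2 → chartRing (![t, c] : Fin 2 → R) 1) ∘ (fun _ : Fin 1 => (1 : Fin 2))) =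
          {chartBase (![t, c] : Fin 2 → R) 1 1 * chartGen (![t, c] : Fin 2 → R) 1 0 +
          chartBase (![t, c] : Fin 2 → R) 1 c ^ 1} := by
        ext y
        simp only [Set.mem_range, Function.comp_apply, Set.mem_singleton_iff]
        constructor
        · rintro ⟨_, rfl⟩; rfl
        · rintro rfl; exact ⟨0, rfl⟩
      rw [hr]
    have hM : Ideal.span (Set.range (Fin.cons (chartBase (![t, c] : Fin 2 → R) 1 c)
        (fun _ : Fin 1 => chartBase (![t, c] : Fin 2 → R) 1 1 * chartGen (![t, c] : Fin 2 → R) 1 0 +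
          chartBase (![t, c] : Fin 2 → R) 1 c ^ 1) :
          Fin 2 → chartRing (![t, c] : Fin 2 → R) 1)) =
        Ideal.span {chartBase (![t, c] : Fin 2 → R) 1 1 * chartGen (![t, c] : Fin 2 → R) 1 0 +
          chartBase (![t, c] : Fin 2 → R) 1 c ^ 1} ⊔
          Ideal.span {chartBase (![t, c] : Fin 2 → R) 1 c} := by
      rw [Fin.range_cons, Set.range_const, Ideal.span_insert, sup_comm]
    have htower := isRegular_of_isBlowup_tower 3 (Fin.cons (chartBase (![t, c] : Fin 2 → R) 1 c)
        (fun _ : Fin 1 => chartBase (![t, c] : Fin 2 → R) 1 1 * chartGen (![t, c] : Fin 2 → R) 1 0 +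
          chartBase (![t, c] : Fin 2 → R) 1 c ^ 1) :
          Fin 2 → chartRing (![t, c] : Fin 2 → R) 1) (fun _ : Fin 1 => (1 : Fin 2))
      (fun a b _ => Subsingleton.elim a b) hx' hR' (Y := Y'') (f := ρ')
    rw [hP, prod_range_three_sup_pow hM] at htower
    exact htower hρ'

end CoreRungTower

end Summit.ResolutionOfSingularities.ResolutionOfSingularities.Theorems

end
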